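import Summits.Ventures.PercRepro.Night2ThreeTwoObstructionThirteen

/-!
# PercRepro — the cell `(3, 2)`: the faces of a covering basis by its points on the common line (night-2, gen 26)

The per-basis loss bound of gen 20 (`sum_faceLoss_le_excessBound`) charges every covering basis `Q = K ∪ T` of a target
the same chord excess `E(n) = (n + 56)/(20 n)`, whatever the position of `T` relative to the common line `ℓ` of the cell.
A basis with `t = |T ∩ ℓ| ≤ 1` points on the line loses less: at most ONE of its four faces `cl (Q ∖ w)` contains `ℓ`
(two faces meet, outside the coloops, in a rank-`2` set, which would then be `cl ℓ ∩ V = ℓ` and contain two basis points),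
every other face meets `ℓ` in at most one point (a plane with two points of `ℓ` contains `ℓ`), so it misses at least
`|ℓ| − 1` points, and the face sum `Σ_w m_w` is at least `3 n − y − 7 + t` (`y = |V ∖ ℓ|`: the points of `ℓ` lie in the
`ℓ`-face and in at most one further face).

* `card_inter_clF_le_one_of_not_subset`: a flat not containing `ℓ` meets it in `≤ 1` point;
* `rkN_inter_faces_sdiff_coloops_le_two`, `not_subset_both_faces`: two faces of a basis with `≤ 1` point on `ℓ` cannot
  both contain `ℓ`;
* `sum_card_inter_faces_le`: `Σ_w |ℓ ∩ cl (Q ∖ w)| ≤ |ℓ| + 3`;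
* **`sum_faces_ge_of_line`**: `Σ_w m_w ≥ 3 n − y − 7 + t`.
The loss bounds themselves (per-face chords, the constants at `n = 11`) are in `Night2ThreeTwoTypeLoss`.
-/

namespace PercRepro.Shadow

open Finset PerFlat ThmH

variable {α : Type*} [DecidableEq α] {M : Matroid α} [M.Finite]

section TypeFaces

variable {G : Finset α}

/-- A flat `F = cl B` not containing a rank-`2` set `ℓ` meets it in at most one point. -/
theorem card_inter_clF_le_one_of_not_subset (hs : ∀ e ∈ gr M, ∀ f ∈ gr M, e ≠ f → rkN M {e, f} = 2)
    {ℓ : Finset α} (hℓg : ℓ ⊆ gr M) (hℓr : rkN M ℓ ≤ 2) {B : Finset α} (hF : ¬ ℓ ⊆ clF M B) :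
    (ℓ ∩ clF M B).card ≤ 1 := by
  by_contra h
  push Not at h
  apply hF
  have h1 := subset_clF_inter_of_rkN_le_two hs hℓg hℓr (X' := clF M B) (by omega)
  refine h1.trans ?_
  calc clF M (ℓ ∩ clF M B) ⊆ clF M (clF M B) := clF_mono Finset.inter_subset_right
    _ = clF M B := clF_clF B

/-- A face of a covering basis contains the coloops. -/
theorem coloops_subset_erase_of_mem_sdiff {Q : Finset α} (hK : coloops M G ⊆ Q) {w : α}
    (hw : w ∈ Q \ coloops M G) : coloops M G ⊆ Q.erase w := by
  intro x hx
  rw [Finset.mem_erase]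
  exact ⟨fun h => (Finset.mem_sdiff.1 hw).2 (h ▸ hx), hK hx⟩

open scoped Classical in
/-- Two distinct faces of a covering basis of the cell (`k = 2`, `ρ = 4`) meet, outside the coloops, in a set of
rank `≤ 2`. -/
theorem rkN_inter_faces_sdiff_coloops_le_two (hG : G ∈ flatsQ M (5 + 1)) (hk : kColoops M G = 2)
    {Q : Finset α} (hQ : Q ∈ shadowAt M (5 + 2) 5 (Uq M (5 + 2) 5) G) (hQc : (Q \ coloops M G).card = 4)
    {w w' : α} (hw : w ∈ Q \ coloops M G) (hw' : w' ∈ Q \ coloops M G) (hne : w ≠ w') :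
    rkN M ((clF M (Q.erase w) ∩ clF M (Q.erase w')) \ coloops M G) ≤ 2 := by
  have hk' : kColoops M G + 4 = 5 + 1 := by omega
  have hGg : G ⊆ gr M := (mem_flatsQ.1 hG).1
  have hQG : Q ⊆ G := subset_G_of_mem_shadowAt hQ
  have hKQ : coloops M G ⊆ Q := coloops_subset_of_mem_shadowAt hQ
  have hclQ : clF M Q = G := (mem_shadowAt.1 hQ).2
  have hI : M.Indep (Q : Set α) := indep_of_mem_shadowAt_card hk' hQ hQc
  set H := clF M (Q.erase w) with hH
  set H' := clF M (Q.erase w') with hH'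
  have hHG : H ⊆ G := by rw [hH, ← hclQ]; exact clF_mono (Finset.erase_subset w Q)
  have hH'G : H' ⊆ G := by rw [hH', ← hclQ]; exact clF_mono (Finset.erase_subset w' Q)
  -- the faces have rank `5`
  have hrk : ∀ u ∈ Q, rkN M (clF M (Q.erase u)) = 5 := by
    intro u hu
    rw [rkN_clF]
    have hIu : M.Indep ((Q.erase u : Finset α) : Set α) := hI.subset (by exact_mod_cast Finset.erase_subset u Q)
    have h := hIu.eRk_eq_encard
    rw [eRk_eq_rkN, Set.encard_coe_eq_coe_finsetCard, Finset.card_erase_of_mem hu] at h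
    have hQ6 : Q.card = 6 := by
      have := Finset.card_sdiff_add_card_inter Q (coloops M G)
      rw [hQc, Finset.inter_eq_right.2 hKQ, ← kColoops_eq_card_coloops, hk] at this
      omega
    rw [hQ6] at h
    exact_mod_cast h
  have hHr : rkN M H = 5 := hrk w (Finset.mem_sdiff.1 hw).1
  have hH'r : rkN M H' = 5 := hrk w' (Finset.mem_sdiff.1 hw').1
  -- `w ∈ H'` but `w ∉ H`
  have hwH' : w ∈ H' := by
    rw [hH']
    apply subset_clF_of_subset_gr ((Finset.erase_subset w' Q).trans (hQG.trans hGg))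
    exact Finset.mem_erase.2 ⟨hne, (Finset.mem_sdiff.1 hw).1⟩
  have hwH : w ∉ H := (Finset.mem_sdiff.1 (mem_sdiff_clF_erase_self hk' hQ hQc (Finset.mem_sdiff.1 hw).1)).2
  have hHclosed : clF M H = H := by rw [hH, clF_clF]
  have hU6 : 6 ≤ rkN M (H ∪ H') := by
    have h1 : rkN M (insert w H) = rkN M H + 1 :=
      rkN_insert_of_notMem_clF (hGg (hQG (Finset.mem_sdiff.1 hw).1)) (by rw [hHclosed]; exact hwH)
    have h2 : insert w H ⊆ H ∪ H' := Finset.insert_subset (Finset.mem_union_right _ hwH') Finset.subset_union_left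
    have := rkN_mono (M := M) h2
    omega
  have hsub := rkN_submod (M := M) H H'
  have hKI : coloops M G ⊆ H ∩ H' := by
    refine Finset.subset_inter ?_ ?_
    · exact (coloops_subset_erase_of_mem_sdiff hKQ hw).trans
        (subset_clF_of_subset_gr ((Finset.erase_subset w Q).trans (hQG.trans hGg)))
    · exact (coloops_subset_erase_of_mem_sdiff hKQ hw').trans
        (subset_clF_of_subset_gr ((Finset.erase_subset w' Q).trans (hQG.trans hGg)))
  have hcol : ∀ y ∈ coloops M G, y ∈ G ∧ y ∉ clF M (G.erase y) := fun y hy => mem_coloops.1 hy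
  have hXG : (H ∩ H') \ coloops M G ⊆ G := fun a ha => hHG (Finset.mem_inter.1 (Finset.mem_sdiff.1 ha).1).1
  have hdisj : Disjoint (coloops M G) ((H ∩ H') \ coloops M G) := Finset.disjoint_sdiff
  have hunion : coloops M G ∪ ((H ∩ H') \ coloops M G) = H ∩ H' := Finset.union_sdiff_of_subset hKI
  have hI2 : rkN M (H ∩ H') = 2 + rkN M ((H ∩ H') \ coloops M G) := by
    have h := eRk_union_coloops hGg (coloops M G) hcol hXG hdisj
    rw [hunion, eRk_eq_rkN, eRk_eq_rkN, ← kColoops_eq_card_coloops, hk] at h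
    exact_mod_cast h
  omega

open scoped Classical in
/-- **Two faces of a covering basis with at most one point on the line cannot both contain the line**: the line
would lie in their rank-`2` intersection, whose closure in `V` is `ℓ` itself, and the two other basis points lie there. -/
theorem not_subset_both_faces (hG : G ∈ flatsQ M (5 + 1)) (hk : kColoops M G = 2)
    (hs : ∀ e ∈ gr M, ∀ f ∈ gr M, e ≠ f → rkN M {e, f} = 2)
    {ℓ : Finset α} (hℓ2 : 2 ≤ ℓ.card) (hℓV : ℓ ⊆ G \ coloops M G)
    (hℓcl : ∀ x ∈ G \ coloops M G, x ∈ clF M ℓ → x ∈ ℓ)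
    {Q : Finset α} (hQ : Q ∈ shadowAt M (5 + 2) 5 (Uq M (5 + 2) 5) G) (hQc : (Q \ coloops M G).card = 4)
    (ht : ((Q \ coloops M G) ∩ ℓ).card ≤ 1)
    {w w' : α} (hw : w ∈ Q \ coloops M G) (hw' : w' ∈ Q \ coloops M G) (hne : w ≠ w')
    (h1 : ℓ ⊆ clF M (Q.erase w)) (h2 : ℓ ⊆ clF M (Q.erase w')) : False := by
  have hGg : G ⊆ gr M := (mem_flatsQ.1 hG).1
  have hQG : Q ⊆ G := subset_G_of_mem_shadowAt hQ
  set X := (clF M (Q.erase w) ∩ clF M (Q.erase w')) \ coloops M G with hX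
  have hXr : rkN M X ≤ 2 := rkN_inter_faces_sdiff_coloops_le_two hG hk hQ hQc hw hw' hne
  have hℓX : ℓ ⊆ X := by
    intro a ha
    rw [hX, Finset.mem_sdiff, Finset.mem_inter]
    exact ⟨⟨h1 ha, h2 ha⟩, (Finset.mem_sdiff.1 (hℓV ha)).2⟩
  have hXG : X ⊆ G := by
    intro a ha
    rw [hX, Finset.mem_sdiff, Finset.mem_inter] at ha
    have hclQ : clF M Q = G := (mem_shadowAt.1 hQ).2
    exact (hclQ ▸ clF_mono (Finset.erase_subset w Q)) ha.1.1
  have hXg : X ⊆ gr M := hXG.trans hGg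
  -- `X ⊆ cl ℓ`
  have hXcl : X ⊆ clF M ℓ := by
    have hXℓ : X ∩ ℓ = ℓ := Finset.inter_eq_right.2 hℓX
    have := subset_clF_inter_of_rkN_le_two hs hXg hXr (X' := ℓ) (by rw [hXℓ]; exact hℓ2)
    rwa [hXℓ] at this
  -- the two other basis points lie in `X`, hence in `ℓ`
  have hother : (Q \ coloops M G) \ {w, w'} ⊆ (Q \ coloops M G) ∩ ℓ := by
    intro u hu
    rw [Finset.mem_sdiff, Finset.mem_insert, Finset.mem_singleton, not_or] at hu
    obtain ⟨huQ, huw, huw'⟩ := hu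
    refine Finset.mem_inter.2 ⟨huQ, ?_⟩
    apply hℓcl u (Finset.mem_sdiff.2 ⟨hQG (Finset.mem_sdiff.1 huQ).1, (Finset.mem_sdiff.1 huQ).2⟩)
    apply hXcl
    rw [hX, Finset.mem_sdiff, Finset.mem_inter]
    refine ⟨⟨?_, ?_⟩, (Finset.mem_sdiff.1 huQ).2⟩
    · exact subset_clF_of_subset_gr ((Finset.erase_subset w Q).trans (hQG.trans hGg))
        (Finset.mem_erase.2 ⟨huw, (Finset.mem_sdiff.1 huQ).1⟩)
    · exact subset_clF_of_subset_gr ((Finset.erase_subset w' Q).trans (hQG.trans hGg))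
        (Finset.mem_erase.2 ⟨huw', (Finset.mem_sdiff.1 huQ).1⟩)
  have hc := Finset.card_le_card hother
  have hpair : ({w, w'} : Finset α).card = 2 := Finset.card_pair hne
  have hsub : ({w, w'} : Finset α) ⊆ Q \ coloops M G := by
    intro u hu
    rw [Finset.mem_insert, Finset.mem_singleton] at hu
    rcases hu with rfl | rfl
    · exact hw
    · exact hw'
  rw [Finset.card_sdiff_of_subset hsub, hQc, hpair] at hc
  omega

open scoped Classical in
/-- **The line meets the four faces in at most `|ℓ| + 3` points in total** (with multiplicity): at most one face
contains `ℓ`, the others meet it in `≤ 1` point. -/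
theorem sum_card_inter_faces_le (hG : G ∈ flatsQ M (5 + 1)) (hk : kColoops M G = 2)
    (hs : ∀ e ∈ gr M, ∀ f ∈ gr M, e ≠ f → rkN M {e, f} = 2)
    {ℓ : Finset α} (hℓr : rkN M ℓ ≤ 2) (hℓ2 : 2 ≤ ℓ.card) (hℓV : ℓ ⊆ G \ coloops M G)
    (hℓcl : ∀ x ∈ G \ coloops M G, x ∈ clF M ℓ → x ∈ ℓ)
    {Q : Finset α} (hQ : Q ∈ shadowAt M (5 + 2) 5 (Uq M (5 + 2) 5) G) (hQc : (Q \ coloops M G).card = 4)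
    (ht : ((Q \ coloops M G) ∩ ℓ).card ≤ 1) :
    ∑ w ∈ Q \ coloops M G, (ℓ ∩ clF M (Q.erase w)).card ≤ ℓ.card + 3 := by
  have hGg : G ⊆ gr M := (mem_flatsQ.1 hG).1
  have hℓg : ℓ ⊆ gr M := fun a ha => hGg (Finset.mem_sdiff.1 (hℓV ha)).1
  set T := Q \ coloops M G with hT
  have hterm : ∀ w ∈ T, (ℓ ∩ clF M (Q.erase w)).card ≤ if ℓ ⊆ clF M (Q.erase w) then ℓ.card else 1 := by
    intro w _
    split_ifs with h
    · exact Finset.card_le_card Finset.inter_subset_left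
    · exact card_inter_clF_le_one_of_not_subset hs hℓg hℓr h
  have hfilt : (T.filter (fun w => ℓ ⊆ clF M (Q.erase w))).card ≤ 1 := by
    rw [Finset.card_le_one]
    intro w hw w' hw'
    rw [Finset.mem_filter] at hw hw'
    by_contra hne
    exact not_subset_both_faces hG hk hs hℓ2 hℓV hℓcl hQ hQc ht hw.1 hw'.1 hne hw.2 hw'.2
  have hsplit := Finset.card_filter_add_card_filter_not (s := T) (fun w => ℓ ⊆ clF M (Q.erase w))
  calc ∑ w ∈ T, (ℓ ∩ clF M (Q.erase w)).card
      ≤ ∑ w ∈ T, (if ℓ ⊆ clF M (Q.erase w) then ℓ.card else 1) := Finset.sum_le_sum hterm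
    _ = (T.filter (fun w => ℓ ⊆ clF M (Q.erase w))).card * ℓ.card +
        (T.filter (fun w => ¬ ℓ ⊆ clF M (Q.erase w))).card * 1 := by
        rw [Finset.sum_ite, Finset.sum_const, Finset.sum_const, smul_eq_mul, smul_eq_mul]
    _ ≤ ℓ.card + 3 := by
        rw [hQc] at hsplit
        rcases Nat.le_one_iff_eq_zero_or_eq_one.1 hfilt with h0 | h1
        · rw [h0] at hsplit ⊢; omega
        · rw [h1] at hsplit ⊢; omega

/-- Double counting: `Σ_{w ∈ T} |X ∖ F w| = Σ_{x ∈ X} #{w ∈ T : x ∉ F w}`. -/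
theorem sum_card_sdiff_eq_sum_card_filter (T X : Finset α) (F : α → Finset α) :
    ∑ w ∈ T, (X \ F w).card = ∑ x ∈ X, (T.filter (fun w => x ∉ F w)).card := by
  have h1 : ∀ w ∈ T, (X \ F w).card = ∑ x ∈ X, if x ∉ F w then 1 else 0 := by
    intro w _
    rw [Finset.sdiff_eq_filter, Finset.card_filter]
  have h2 : ∀ x ∈ X, (T.filter (fun w => x ∉ F w)).card = ∑ w ∈ T, if x ∉ F w then 1 else 0 := by
    intro x _
    rw [Finset.card_filter]
  rw [Finset.sum_congr rfl h1, Finset.sum_congr rfl h2, Finset.sum_comm]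

open scoped Classical in
/-- **THE FACE SUM ALONG THE LINE**: for a covering basis `Q` of the cell with `t ≤ 1` points on `ℓ`,
`Σ_w m_w ≥ 3 n − y − 7 + t` (`n = |V|`, `y = |V ∖ ℓ|`, `m_w = |G ∖ cl (Q ∖ w)|`). -/
theorem sum_faces_ge_of_line (hG : G ∈ flatsQ M (5 + 1)) (hk : kColoops M G = 2)
    (hs : ∀ e ∈ gr M, ∀ f ∈ gr M, e ≠ f → rkN M {e, f} = 2) (hl : ∀ e ∈ gr M, M.Indep {e})
    {ℓ : Finset α} (hℓr : rkN M ℓ ≤ 2) (hℓ2 : 2 ≤ ℓ.card) (hℓV : ℓ ⊆ G \ coloops M G)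
    (hℓcl : ∀ x ∈ G \ coloops M G, x ∈ clF M ℓ → x ∈ ℓ)
    {Q : Finset α} (hQ : Q ∈ shadowAt M (5 + 2) 5 (Uq M (5 + 2) 5) G) (hQc : (Q \ coloops M G).card = 4)
    (ht : ((Q \ coloops M G) ∩ ℓ).card ≤ 1) :
    3 * (G \ coloops M G).card + ((Q \ coloops M G) ∩ ℓ).card ≤
      ((G \ coloops M G) \ ℓ).card + 7 + ∑ w ∈ Q \ coloops M G, (G \ clF M (Q.erase w)).card := by
  have hk' : kColoops M G + 4 = 5 + 1 := by omega
  have hQG : Q ⊆ G := subset_G_of_mem_shadowAt hQ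
  have hKQ : coloops M G ⊆ Q := coloops_subset_of_mem_shadowAt hQ
  set T := Q \ coloops M G with hT
  set V := G \ coloops M G with hV
  -- `G ∖ F w ⊇ (ℓ ∖ F w) ⊔ ((V ∖ ℓ) ∖ F w)`
  have hge : ∀ w ∈ T, (ℓ \ clF M (Q.erase w)).card + ((V \ ℓ) \ clF M (Q.erase w)).card ≤ (G \ clF M (Q.erase w)).card := by
    intro w _
    rw [← Finset.card_union_of_disjoint]
    · apply Finset.card_le_card
      intro a ha
      rw [Finset.mem_union, Finset.mem_sdiff, Finset.mem_sdiff, Finset.mem_sdiff, Finset.mem_sdiff] at ha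
      rw [Finset.mem_sdiff]
      rcases ha with ⟨haℓ, haF⟩ | ⟨⟨⟨haG, -⟩, -⟩, haF⟩
      · exact ⟨(Finset.mem_sdiff.1 (hℓV haℓ)).1, haF⟩
      · exact ⟨haG, haF⟩
    · rw [Finset.disjoint_left]
      intro a ha hb
      exact (Finset.mem_sdiff.1 (Finset.mem_sdiff.1 hb).1).2 (Finset.mem_sdiff.1 ha).1
  have hsum1 : ∑ w ∈ T, (ℓ \ clF M (Q.erase w)).card + ∑ w ∈ T, ((V \ ℓ) \ clF M (Q.erase w)).card ≤ ∑ w ∈ T, (G \ clF M (Q.erase w)).card := by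
    rw [← Finset.sum_add_distrib]
    exact Finset.sum_le_sum hge
  -- the `ℓ` part: `Σ_w |ℓ ∖ F w| = 4 |ℓ| − Σ_w |ℓ ∩ F w| ≥ 3 |ℓ| − 3`
  have hℓpart : 3 * ℓ.card ≤ ∑ w ∈ T, (ℓ \ clF M (Q.erase w)).card + 3 := by
    have h1 : ∀ w ∈ T, (ℓ \ clF M (Q.erase w)).card + (ℓ ∩ clF M (Q.erase w)).card = ℓ.card := fun w _ => Finset.card_sdiff_add_card_inter ℓ (clF M (Q.erase w))
    have h2 : ∑ w ∈ T, (ℓ \ clF M (Q.erase w)).card + ∑ w ∈ T, (ℓ ∩ clF M (Q.erase w)).card = 4 * ℓ.card := by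
      rw [← Finset.sum_add_distrib, Finset.sum_congr rfl h1, Finset.sum_const, hQc, smul_eq_mul]
    have h3 : ∑ w ∈ T, (ℓ ∩ clF M (Q.erase w)).card ≤ ℓ.card + 3 :=
      sum_card_inter_faces_le hG hk hs hℓr hℓ2 hℓV hℓcl hQ hQc ht
    omega
  -- the off-line part: `x ∈ T ∖ ℓ` misses its own face, `x ∈ (V ∖ ℓ) ∖ T` misses two faces
  have hoff : (T \ ℓ).card + 2 * ((V \ ℓ) \ T).card ≤ ∑ w ∈ T, ((V \ ℓ) \ clF M (Q.erase w)).card := by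
    have hsw := sum_card_sdiff_eq_sum_card_filter T (V \ ℓ) (fun w => clF M (Q.erase w))
    beta_reduce at hsw
    rw [hsw]
    have hTV : T ⊆ V := Finset.sdiff_subset_sdiff hQG (Finset.Subset.refl _)
    have hdisj : Disjoint (T \ ℓ) ((V \ ℓ) \ T) := by
      rw [Finset.disjoint_left]
      intro a ha hb
      exact (Finset.mem_sdiff.1 hb).2 (Finset.mem_sdiff.1 ha).1
    have hunion : (T \ ℓ) ∪ ((V \ ℓ) \ T) = V \ ℓ := by
      ext a
      simp only [Finset.mem_union, Finset.mem_sdiff]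
      constructor
      · rintro (⟨haT, haℓ⟩ | ⟨⟨haV, haℓ⟩, -⟩)
        · exact ⟨hTV haT, haℓ⟩
        · exact ⟨haV, haℓ⟩
      · rintro ⟨haV, haℓ⟩
        by_cases haT : a ∈ T
        · exact Or.inl ⟨haT, haℓ⟩
        · exact Or.inr ⟨⟨haV, haℓ⟩, haT⟩
    have hsplitsum : ∑ x ∈ V \ ℓ, (T.filter (fun w => x ∉ clF M (Q.erase w))).card =
        ∑ x ∈ T \ ℓ, (T.filter (fun w => x ∉ clF M (Q.erase w))).card +
          ∑ x ∈ (V \ ℓ) \ T, (T.filter (fun w => x ∉ clF M (Q.erase w))).card := by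
      rw [← Finset.sum_union hdisj, hunion]
    rw [hsplitsum]
    have hA : (T \ ℓ).card ≤ ∑ x ∈ T \ ℓ, (T.filter (fun w => x ∉ clF M (Q.erase w))).card := by
      calc (T \ ℓ).card = ∑ _x ∈ T \ ℓ, 1 := by rw [Finset.sum_const, smul_eq_mul, mul_one]
        _ ≤ ∑ x ∈ T \ ℓ, (T.filter (fun w => x ∉ clF M (Q.erase w))).card := by
            apply Finset.sum_le_sum
            intro x hx
            apply Finset.card_pos.2
            refine ⟨x, Finset.mem_filter.2 ⟨(Finset.mem_sdiff.1 hx).1, ?_⟩⟩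
            exact (Finset.mem_sdiff.1 (mem_sdiff_clF_erase_self hk' hQ hQc
              (Finset.mem_sdiff.1 (Finset.mem_sdiff.1 hx).1).1)).2
    have hB : 2 * ((V \ ℓ) \ T).card ≤ ∑ x ∈ (V \ ℓ) \ T, (T.filter (fun w => x ∉ clF M (Q.erase w))).card := by
      calc 2 * ((V \ ℓ) \ T).card = ∑ _x ∈ (V \ ℓ) \ T, 2 := by rw [Finset.sum_const, smul_eq_mul, mul_comm]
        _ ≤ ∑ x ∈ (V \ ℓ) \ T, (T.filter (fun w => x ∉ clF M (Q.erase w))).card := by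
            apply Finset.sum_le_sum
            intro x hx
            have hxGQ : x ∈ G \ Q := by
              rw [Finset.mem_sdiff, Finset.mem_sdiff, Finset.mem_sdiff] at hx
              rw [Finset.mem_sdiff]
              refine ⟨hx.1.1.1, fun hxQ => hx.2 (Finset.mem_sdiff.2 ⟨hxQ, hx.1.1.2⟩)⟩
            exact two_le_card_support hG hk' hs hl hQ hQc hxGQ
    omega
  -- the cardinalities: `|T ∖ ℓ| + |T ∩ ℓ| = 4`, `|(V ∖ ℓ) ∖ T| + |T ∖ ℓ| = |V ∖ ℓ|`, `|ℓ| + |V ∖ ℓ| = |V|`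
  have hTsplit : (T \ ℓ).card + (T ∩ ℓ).card = T.card := Finset.card_sdiff_add_card_inter T ℓ
  have hVsplit : ((V \ ℓ) \ T).card + (T \ ℓ).card = (V \ ℓ).card := by
    have hTV : T ⊆ V := Finset.sdiff_subset_sdiff hQG (Finset.Subset.refl _)
    have hsub : T \ ℓ ⊆ V \ ℓ := Finset.sdiff_subset_sdiff hTV (Finset.Subset.refl _)
    have e1 : (V \ ℓ) \ T = (V \ ℓ) \ (T \ ℓ) := by
      ext a
      simp only [Finset.mem_sdiff]
      tauto
    rw [e1, Finset.card_sdiff_of_subset hsub]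
    have := Finset.card_le_card hsub
    omega
  have hℓV' : ℓ.card + (V \ ℓ).card = V.card := by
    rw [Finset.card_sdiff_of_subset hℓV]
    have := Finset.card_le_card hℓV
    omega
  rw [hQc] at hTsplit
  omega

end TypeFaces

end PercRepro.Shadow
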